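import Summits.CriticalPhenomena.PercolationContinuityZ3.Theorems.PercNearOneGluingNoHeavyLowerTailKnQuestion8CoefficientwiseCoreClassKernelMixTransfer
import HarnessLib

/-!
# KB-MIX is stable under terminal leaves

Support file (`--supports stmt-CriticalPhenomena-4575`, closed), prover `prim-cplus-coupling` (gen 31).  No definitions, no notations, no named facts,
no sorries; standard axioms.  Memo `prim-cplus-coupling/A5-COUPLING-gen31.md` §1.  Companions `…CoreClassKernelMix` (the invariant, its terminal
symmetry, KB-MIX from a proper domination map, KB-MIX ⟹ kernel), `…CoreClassKernelMixTransfer` (the generic remainder inequality).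

Setting: middle graph `E` with terminals `a, b`; a NEW edge `e ∉ E` with `ends e = s(a′, a)`, `a′` on no edge of `E`, `a′ ≠ a, b`; the enlarged middle
graph `insert e E` with terminals `a′, b`.  `C_v(ω) = openCluster (ends '' ω) v`.
* `Coefficientwise.coreClass_kernelMix_leaf` — **the leaf step**: if KB-MIX holds for `(E; a, b)` at the level functions
  `h(a′ ∪ ·), k(a′ ∪ ·); hᵃ(a′ ∪ ·), hᵇ; kᵃ(a′ ∪ ·), kᵇ`, then KB-MIX holds for `(insert e E; a′, b)` at `h, k; hᵃ, hᵇ; kᵃ, kᵇ`: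
  `0 ≤ Σ_{ω′ ⊆ E′ : b ∉ C_{a′} ω′} h(C_{a′} ∪ C_b)k(C_{a′} ∪ C_b) + Σ_{ω′ : b ∉ C_{a′} ω′, b ∉ C_{a′}(E′∖ω′)} (hᵃ(C_{a′} ω′) − hᵇ(C_b(E′∖ω′)))(kᵃ(C_{a′} ω′) − kᵇ(C_b(E′∖ω′)))`.
  Proof: split along the colour of `e` (pendant-edge cluster identities of `…CoreClassDomLeafClusters`); the `e`-red supply (index `b ∉ C_a ω`) and the
  wall part of the `e`-red anti-term ARE the assumed instance of KB-MIX for `(E; a, b)`; everything else is `coreClass_kernelMix_transfer`.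
Since KB-MIX is symmetric in the terminals (`coreClass_kernelMix_comm`), the step iterates at both ends: pendant paths at `a` and at `b` of any middle graph
with a proper domination map (pocket-free, bundles, `a ~ V ∖ b`, parallel products) stay in the class — `…CoreClassKernelMixMain`.
[cite: KozmaNitzan2024, Questions 8–9 (§5.5 p. 36) (context: the Question-8 pocket covariance programme)]
-/

namespace Summit.CriticalPhenomena.PercolationContinuityZ3.Theorems

open Finset Literature.Probability.Percolation

namespace Coefficientwise

variable {ι V : Type*}

open Classical in
/-- **KB-MIX leaf step.**  Middle graph `E`, terminals `a, b`, a new edge `e ∉ E` with `ends e = s(a′, a)`, `a′` on no edge of `E`, `a′ ≠ a`, `a′ ≠ b`;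
monotone test functions `h, k` and levels `0 ≤ hᵃ, hᵇ ≤ h`, `0 ≤ kᵃ, kᵇ ≤ k` on `Set V`.  If
`0 ≤ Σ_{ω ⊆ E : b ∉ C_a ω} h(a′ ∪ C_a ω ∪ C_b ω)k(a′ ∪ C_a ω ∪ C_b ω) + Σ_{ω : b ∉ C_a ω, b ∉ C_a(E∖ω)} (hᵃ(a′ ∪ C_a ω) − hᵇ(C_b(E∖ω)))(kᵃ(a′ ∪ C_a ω) − kᵇ(C_b(E∖ω)))`
(KB-MIX of `(E; a, b)` at the shifted levels) then, with `E′ = insert e E`,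
`0 ≤ Σ_{ω ⊆ E′ : b ∉ C_{a′} ω} h(C_{a′} ω ∪ C_b ω)k(C_{a′} ω ∪ C_b ω) + Σ_{ω ⊆ E′ : b ∉ C_{a′} ω, b ∉ C_{a′}(E′∖ω)} (hᵃ(C_{a′} ω) − hᵇ(C_b(E′∖ω)))(kᵃ(C_{a′} ω) − kᵇ(C_b(E′∖ω)))`
(KB-MIX of `(E′; a′, b)`). [cite: KozmaNitzan2024, Questions 8–9 (§5.5 p. 36) (context)] -/
theorem coreClass_kernelMix_leaf (ends : ι → Sym2 V) (E : Finset ι) (e : ι) (a a' b : V) (he : e ∉ E) (hends : ends e = s(a', a))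
    (ha'E : ∀ i ∈ E, a' ∉ ends i) (ha'a : a' ≠ a) (ha'b : a' ≠ b)
    (h k ha hb ka kb : Set V → ℝ) (hh : Monotone h) (hk : Monotone k)
    (mha : Monotone ha) (mhb : Monotone hb) (mka : Monotone ka) (mkb : Monotone kb)
    (ha0 : ∀ X, 0 ≤ ha X) (hah : ∀ X, ha X ≤ h X) (hb0 : ∀ X, 0 ≤ hb X) (hbh : ∀ X, hb X ≤ h X)
    (ka0 : ∀ X, 0 ≤ ka X) (kak : ∀ X, ka X ≤ k X) (kb0 : ∀ X, 0 ≤ kb X) (kbk : ∀ X, kb X ≤ k X)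
    (hmix : 0 ≤ (∑ ω ∈ E.powerset.filter (fun ω : Finset ι => b ∉ openCluster (ends '' (↑ω : Set ι)) a),
        h (insert a' (openCluster (ends '' (↑ω : Set ι)) a ∪ openCluster (ends '' (↑ω : Set ι)) b)) *
          k (insert a' (openCluster (ends '' (↑ω : Set ι)) a ∪ openCluster (ends '' (↑ω : Set ι)) b)))
      + ∑ ω ∈ E.powerset.filter (fun ω : Finset ι => b ∉ openCluster (ends '' (↑ω : Set ι)) a ∧ b ∉ openCluster (ends '' (↑(E \ ω) : Set ι)) a),
        (ha (insert a' (openCluster (ends '' (↑ω : Set ι)) a)) - hb (openCluster (ends '' (↑(E \ ω) : Set ι)) b)) *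
          (ka (insert a' (openCluster (ends '' (↑ω : Set ι)) a)) - kb (openCluster (ends '' (↑(E \ ω) : Set ι)) b))) :
    0 ≤ (∑ ω ∈ (insert e E).powerset.filter (fun ω : Finset ι => b ∉ openCluster (ends '' (↑ω : Set ι)) a'),
        h (openCluster (ends '' (↑ω : Set ι)) a' ∪ openCluster (ends '' (↑ω : Set ι)) b) *
          k (openCluster (ends '' (↑ω : Set ι)) a' ∪ openCluster (ends '' (↑ω : Set ι)) b))
      + ∑ ω ∈ (insert e E).powerset.filter (fun ω : Finset ι => b ∉ openCluster (ends '' (↑ω : Set ι)) a' ∧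
            b ∉ openCluster (ends '' (↑((insert e E) \ ω) : Set ι)) a'),
        (ha (openCluster (ends '' (↑ω : Set ι)) a') - hb (openCluster (ends '' (↑((insert e E) \ ω) : Set ι)) b)) *
          (ka (openCluster (ends '' (↑ω : Set ι)) a') - kb (openCluster (ends '' (↑((insert e E) \ ω) : Set ι)) b)) := by
  set C : Finset ι → V → Set V := fun ω v => openCluster (ends '' (↑ω : Set ι)) v with hC
  set E' : Finset ι := insert e E with hE'
  change 0 ≤ (∑ ω ∈ E.powerset.filter (fun ω : Finset ι => b ∉ C ω a), h (insert a' (C ω a ∪ C ω b)) * k (insert a' (C ω a ∪ C ω b)))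
      + ∑ ω ∈ E.powerset.filter (fun ω : Finset ι => b ∉ C ω a ∧ b ∉ C (E \ ω) a),
        (ha (insert a' (C ω a)) - hb (C (E \ ω) b)) * (ka (insert a' (C ω a)) - kb (C (E \ ω) b)) at hmix
  change 0 ≤ (∑ ω ∈ E'.powerset.filter (fun ω : Finset ι => b ∉ C ω a'), h (C ω a' ∪ C ω b) * k (C ω a' ∪ C ω b))
      + ∑ ω ∈ E'.powerset.filter (fun ω : Finset ι => b ∉ C ω a' ∧ b ∉ C (E' \ ω) a'),
        (ha (C ω a') - hb (C (E' \ ω) b)) * (ka (C ω a') - kb (C (E' \ ω) b))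
  have hCmono : ∀ {ω ω' : Finset ι} (v : V), ω ⊆ ω' → C ω v ⊆ C ω' v := fun v hle => openCluster_image_mono ends hle v
  -- finset identities for the leaf edge
  have hsdiff_ins : ∀ ω, ω ⊆ E → E' \ insert e ω = E \ ω := by
    intro ω hω; ext i
    simp only [hE', Finset.mem_sdiff, Finset.mem_insert, not_or]
    constructor
    · rintro ⟨h1, h2, h3⟩; rcases h1 with h1 | h1; exact absurd h1 h2; exact ⟨h1, h3⟩
    · rintro ⟨h1, h2⟩; exact ⟨Or.inr h1, fun h3 => he (h3 ▸ h1), h2⟩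
  have hsdiff : ∀ ω, ω ⊆ E → E' \ ω = insert e (E \ ω) := by
    intro ω hω; ext i
    simp only [hE', Finset.mem_sdiff, Finset.mem_insert]
    constructor
    · rintro ⟨h1, h2⟩; rcases h1 with h1 | h1; exact Or.inl h1; exact Or.inr ⟨h1, h2⟩
    · rintro (h1 | ⟨h1, h2⟩); exact ⟨Or.inl h1, fun h3 => he (h1 ▸ hω h3)⟩; exact ⟨Or.inr h1, h2⟩
  -- cluster identities (ω ⊆ E)
  have ha'c : ∀ c, c ⊆ E → ∀ i ∈ c, a' ∉ ends i := fun c hc i hi => ha'E i (hc hi)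
  have cl_root0 : ∀ c, c ⊆ E → C c a' = {a'} := fun c hc => openCluster_eq_singleton_of_no_edge_at ends c (ha'c c hc)
  have cl_root1 : ∀ c, c ⊆ E → C (insert e c) a' = insert a' (C c a) := fun c hc => openCluster_leaf_root_insert ends c hends (ha'c c hc)
  have cl_other : ∀ c, c ⊆ E → C (insert e c) b ⊆ C c b ∪ {y | y = a' ∧ a ∈ C c b} :=
    fun c hc => openCluster_leaf_other_insert_subset ends c hends (ha'c c hc) ha'a ha'b.symm
  have cl_other_eq : ∀ c, c ⊆ E → a ∉ C c b → C (insert e c) b = C c b := by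
    intro c hc hac
    apply Set.Subset.antisymm
    · intro y hy; rcases cl_other c hc hy with hy' | ⟨_, hy'⟩; exact hy'; exact absurd hy' hac
    · exact hCmono b (Finset.subset_insert e c)
  have cl_union1 : ∀ c, c ⊆ E → C (insert e c) a' ∪ C (insert e c) b = insert a' (C c a ∪ C c b) := by
    intro c hc
    rw [cl_root1 c hc]
    apply Set.Subset.antisymm
    · intro y hy
      rcases hy with hy | hy
      · rcases hy with hy | hy; exact Or.inl hy; exact Or.inr (Or.inl hy)
      · rcases cl_other c hc hy with hy' | ⟨hy', _⟩; exact Or.inr (Or.inr hy'); exact Or.inl hy'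
    · intro y hy
      rcases hy with hy | hy
      · exact Or.inl (Or.inl hy)
      · rcases hy with hy | hy; exact Or.inl (Or.inr hy); exact Or.inr (hCmono b (Finset.subset_insert e c) hy)
  have cl_union0 : ∀ c, c ⊆ E → C c a' ∪ C c b = insert a' (C c b) := by
    intro c hc; rw [cl_root0 c hc]; rfl
  -- split the two sums along the colour of `e`
  rw [Finset.sum_filter, Finset.sum_filter, hE', Finset.sum_powerset_insert he, Finset.sum_powerset_insert he]
  -- supply, e blue: every configuration qualifies; S' = insert a' (C ω b)
  have S0 : ∑ ω ∈ E.powerset, (if b ∉ C ω a' then h (C ω a' ∪ C ω b) * k (C ω a' ∪ C ω b) else 0) =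
      ∑ ω ∈ E.powerset, h (insert a' (C ω b)) * k (insert a' (C ω b)) := by
    refine Finset.sum_congr rfl fun ω hω => ?_
    have hω := Finset.mem_powerset.mp hω
    have hcond : b ∉ C ω a' := by rw [cl_root0 ω hω, Set.mem_singleton_iff]; exact ha'b.symm
    rw [if_pos hcond, cl_union0 ω hω]
  -- supply, e red: qualifies iff `b ∉ C ω a`; S' = insert a' S
  have S1 : ∑ ω ∈ E.powerset, (if b ∉ C (insert e ω) a' then h (C (insert e ω) a' ∪ C (insert e ω) b) * k (C (insert e ω) a' ∪ C (insert e ω) b) else 0) =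
      ∑ ω ∈ E.powerset, (if b ∉ C ω a then h (insert a' (C ω a ∪ C ω b)) * k (insert a' (C ω a ∪ C ω b)) else 0) := by
    refine Finset.sum_congr rfl fun ω hω => ?_
    have hω := Finset.mem_powerset.mp hω
    have hiff : b ∉ C (insert e ω) a' ↔ b ∉ C ω a := by
      rw [cl_root1 ω hω, Set.mem_insert_iff, not_or]
      exact ⟨fun hx => hx.2, fun hx => ⟨ha'b.symm, hx⟩⟩
    by_cases hw : b ∉ C ω a
    · rw [if_pos (hiff.mpr hw), if_pos hw, cl_union1 ω hω]
    · rw [if_neg (fun hx => hw (hiff.mp hx)), if_neg hw]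
  -- anti term, e blue: wall ⟺ a ∉ C (E \ ω) b; P' = {a'}, Q' = C (E \ ω) b
  have A0 : ∑ ω ∈ E.powerset, (if b ∉ C ω a' ∧ b ∉ C (insert e E \ ω) a' then
        (ha (C ω a') - hb (C (insert e E \ ω) b)) * (ka (C ω a') - kb (C (insert e E \ ω) b)) else 0) =
      ∑ ω ∈ E.powerset, (if a ∉ C (E \ ω) b then (ha {a'} - hb (C (E \ ω) b)) * (ka {a'} - kb (C (E \ ω) b)) else 0) := by
    refine Finset.sum_congr rfl fun ω hω => ?_
    have hω := Finset.mem_powerset.mp hω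
    rw [← hE', hsdiff ω hω, cl_root0 ω hω, cl_root1 (E \ ω) Finset.sdiff_subset]
    have hiff : (b ∉ ({a'} : Set V) ∧ b ∉ insert a' (C (E \ ω) a)) ↔ a ∉ C (E \ ω) b := by
      rw [Set.mem_singleton_iff, Set.mem_insert_iff, mem_openCluster_comm ends (E \ ω) a b]
      constructor
      · rintro ⟨_, hx⟩; exact fun hy => hx (Or.inr hy)
      · intro hx; exact ⟨ha'b.symm, fun hy => hy.elim (fun hz => ha'b.symm hz) hx⟩
    by_cases hw : a ∉ C (E \ ω) b
    · rw [if_pos (hiff.mpr hw), if_pos hw, cl_other_eq (E \ ω) Finset.sdiff_subset hw]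
    · rw [if_neg (fun hx => hw (hiff.mp hx)), if_neg hw]
  -- anti term, e red: wall ⟺ b ∉ C ω a; P' = insert a' (C ω a), Q' = C (E \ ω) b
  have A1 : ∑ ω ∈ E.powerset, (if b ∉ C (insert e ω) a' ∧ b ∉ C (insert e E \ insert e ω) a' then
        (ha (C (insert e ω) a') - hb (C (insert e E \ insert e ω) b)) * (ka (C (insert e ω) a') - kb (C (insert e E \ insert e ω) b)) else 0) =
      ∑ ω ∈ E.powerset, (if b ∉ C ω a then
        (ha (insert a' (C ω a)) - hb (C (E \ ω) b)) * (ka (insert a' (C ω a)) - kb (C (E \ ω) b)) else 0) := by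
    refine Finset.sum_congr rfl fun ω hω => ?_
    have hω := Finset.mem_powerset.mp hω
    rw [← hE', hsdiff_ins ω hω, cl_root1 ω hω, cl_root0 (E \ ω) Finset.sdiff_subset]
    have hiff : (b ∉ insert a' (C ω a) ∧ b ∉ ({a'} : Set V)) ↔ b ∉ C ω a := by
      rw [Set.mem_singleton_iff, Set.mem_insert_iff]
      constructor
      · rintro ⟨hx, _⟩; exact fun hy => hx (Or.inr hy)
      · intro hx; exact ⟨fun hy => hy.elim (fun hz => ha'b.symm hz) hx, ha'b.symm⟩
    by_cases hw : b ∉ C ω a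
    · rw [if_pos (hiff.mpr hw), if_pos hw]
    · rw [if_neg (fun hx => hw (hiff.mp hx)), if_neg hw]
  rw [S0, S1, A0, A1]
  -- the e-red anti term splits into the wall part of `(E; a, b)` and the part `a ∈ C (E \ ω) b`
  have A1split : ∑ ω ∈ E.powerset, (if b ∉ C ω a then
        (ha (insert a' (C ω a)) - hb (C (E \ ω) b)) * (ka (insert a' (C ω a)) - kb (C (E \ ω) b)) else 0) =
      ∑ ω ∈ E.powerset.filter (fun ω => b ∉ C ω a ∧ b ∉ C (E \ ω) a),
        (ha (insert a' (C ω a)) - hb (C (E \ ω) b)) * (ka (insert a' (C ω a)) - kb (C (E \ ω) b))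
      + ∑ ω ∈ E.powerset, (if b ∉ C ω a ∧ a ∈ C (E \ ω) b then
        (ha (insert a' (C ω a)) - hb (C (E \ ω) b)) * (ka (insert a' (C ω a)) - kb (C (E \ ω) b)) else 0) := by
    rw [Finset.sum_filter, ← Finset.sum_add_distrib]
    refine Finset.sum_congr rfl fun ω _ => ?_
    by_cases h1 : b ∉ C ω a
    · by_cases h2 : a ∈ C (E \ ω) b
      · have h2' : ¬ (b ∉ C (E \ ω) a) := fun hx => hx ((mem_openCluster_comm ends (E \ ω) a b).mpr h2)
        rw [if_pos h1, if_neg (fun hx => h2' hx.2), if_pos ⟨h1, h2⟩]; ring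
      · have h2' : b ∉ C (E \ ω) a := fun hx => h2 ((mem_openCluster_comm ends (E \ ω) a b).mp hx)
        rw [if_pos h1, if_pos ⟨h1, h2'⟩, if_neg (fun hx => h2 hx.2)]; ring
    · rw [if_neg h1, if_neg (fun hx => h1 hx.1), if_neg (fun hx => h1 hx.1)]; ring
  rw [A1split]
  rw [Finset.sum_filter] at hmix
  -- the remainder is the transfer inequality at the shifted levels
  have h1_ge : ∀ X : Set V, h X ≤ h (insert a' X) := fun X => hh (Set.subset_insert _ _)
  have k1_ge : ∀ X : Set V, k X ≤ k (insert a' X) := fun X => hk (Set.subset_insert _ _)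
  have hsing : ∀ X : Set V, ({a'} : Set V) ⊆ insert a' X := fun X => Set.singleton_subset_iff.mpr (Set.mem_insert _ _)
  have htr := coreClass_kernelMix_transfer ends E a b (fun X => h (insert a' X)) (fun X => k (insert a' X))
    (fun X => ha (insert a' X)) hb (fun X => ka (insert a' X)) kb (ha {a'}) (ka {a'})
    (fun X Y hXY => mha (Set.insert_subset_insert hXY)) mhb (fun X Y hXY => mka (Set.insert_subset_insert hXY)) mkb
    (fun X => ha0 _) (fun X => hah _) (fun X => hb0 _) (fun X => le_trans (hbh X) (h1_ge X))
    (fun X => ka0 _) (fun X => kak _) (fun X => kb0 _) (fun X => le_trans (kbk X) (k1_ge X))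
    (ha0 _) (fun X => le_trans (hah _) (hh (hsing X))) (ka0 _) (fun X => le_trans (kak _) (hk (hsing X)))
  linarith

end Coefficientwise

end Summit.CriticalPhenomena.PercolationContinuityZ3.Theorems
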